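import Literature.Probability.RandomPlanarGeometry.HexSAWStripSurfaceGrowth
import Literature.Probability.RandomPlanarGeometry.HexSAWBrickWallStripFugacityInsertion
import Literature.Probability.RandomPlanarGeometry.HexSAWBrickWallStripMargin
import HarnessLib

/-!
# BBdGDCG14 Proposition 7 for the TOP-LEVEL surface weight: `ν_T(y) < ν_{T+1}(y)` for every `y ≥ 1`, with a margin

Topic `Literature/Probability/RandomPlanarGeometry` (continues `HexSAWStripSurfaceGrowth.lean` — the top-level-weighted
partition functions `HV.stripZL T n y` of the Duminil-Copin–Smirnov strip `S_T` and their Fekete rate `HV.stripNu T y = ν_T(y)` —,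
the lane's four-column insertion `HexBW.stripInsertion` (`HexSAWBrickWallStripInsertion.lean`, door «HEX-STRIP-STRICT») with its
surface bookkeeping `HexSAWBrickWallStripFugacityInsertion.lean` (`StripInsertion.block_eq_cons`, the image list), the
extraction lemma `MarginExtraction.log_margin_of_core` (`HexSAWBrickWallStripMargin.lean`) and the dictionary
`HexBW.rowIso` / `HV.toPair` (`HexSAWBrickWallStripDictionary.lean`, `HexSAWStripPairsTransfer.lean`)).
Source: N. R. Beaton, M. Bousquet-Mélou, J. de Gier, H. Duminil-Copin, A. J. Guttmann, *The critical fugacity for surface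
adsorption of self-avoiding walks on the honeycomb lattice is `1 + √2`*, Comm. Math. Phys. 326 (2014) 727–754,
arXiv:1109.0358v5, Proposition 7 (p. 11): "For `y > 0`, we have `μ_T(1,y) < μ_{T+1}(1,y)`" (printed proof pp. 11–12 via prime
unfolded arches; Proposition 6, p. 10: `μ_T(y,1) = μ_T(1,y)` by the symmetry of the strip).

## What is proved (standard axioms)

The tree's `HexBW.stripMuY_lt_succ` (a-p5, `HexSAWBrickWallStripFugacityStrict.lean`) is Proposition 7 for a fugacity on the
whole bottom ROW of the brick-wall strip (two levels of `ℍ`).  The threshold `y_T` of the lane (`HV.stripYT`, BBdGDCG14 §4)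
weighs ONE level (the top level `2T − 1`, `HV.surfContacts`), and `HexSAWStripSurfaceThresholdRate.lean` reduces the strict
monotonicity `y_{T+1} < y_T` to the strict Proposition 7 for THAT weight at `y = y_T ≥ 1`.  This file proves it for all `y ≥ 1`:

* brick-wall side (namespace `HexBW`): `lev0` (bottom row AND odd column = the level `0` of `ℍ` under `rowIso`), `levVisits`,
  `stripZlev T n y = Σ_{stripPairs T n} y^{levVisits}`, `StripInsertion.lev0_smap` (the insertion moves columns by multiples of
  `4`), `StripInsertion.visitsL_le_countP_imageList`, **`levVisits_stripInsertion_ge`** (`i₀(ω) ≤ i₀(Ψ(ω,R))`) and the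
  **level core** `lev_core`: for `y ≥ 1`, `0 < x ≤ 1`,
  `Zlev_{T,n}(y) xⁿ (1 + x^{4T+8})^{⌊n/(2(T+1))⌋} ≤ Σ_{m ≤ (4T+9)n} Zlev_{T+1,m}(y) x^m`;
* honeycomb side (namespace `HV`): `botCnt`, `stripZB`, the top↔bottom reflection `tbFlip T` of `S_T` with
  **`stripZL_eq_stripZB`**; the dictionary **`stripZB_le`** (`Z^{bot}_{T,n}(y) ≤ 2T · Zlev_{T−1,n}(y)`, via `toPair`) and
  **`stripZlev_le`** (`Zlev_{T,m}(y) ≤ 2(T+1) · Z^{bot}_{T+1,m}(y)`, via `rowIso` and `xstd`);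
* **`log_stripNu_succ_sub_log_ge (1 ≤ T) (1 ≤ y)`** — the margin
  `log(1 + ν_{T+1}(y)^{-(4T+4)})/(2T) ≤ log ν_{T+1}(y) − log ν_T(y)` — and **`stripNu_lt_succ (1 ≤ T) (1 ≤ y) : ν_T(y) < ν_{T+1}(y)`**.

Label: CONSOLIDATION BY A DIFFERENT PROOF of Proposition 7 (strict part) for the top-level weight and `y ≥ 1`, with an explicit
margin (not in print); mechanism = the lane's insertion (a-p5/a-p2), not the printed arch factorisation.  Lane «pcv-sawmu», a-p2 g10.
-/

noncomputable section

open Finset Filter Topology Literature.Probability.LatticeModels Literature.Probability.Percolation SimpleGraph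

namespace Literature.Probability.RandomPlanarGeometry.SAW

/-! ## Brick-wall side: the level-`0` visit count under the four-column insertion -/

namespace HexBW

/-- The test "bottom row and odd column" — the sites of the brick-wall strip lying on the level `0` of `ℍ` under `rowIso`
(`lev_rowIso`: `lev = 2y + 1 − (x + y) mod 2`). [cite: DuminilCopinSmirnov2012, §3 (the levels of S_T); EntingJensen2009, §7.4.2 (brickwork form)] -/
def lev0 (z : Site 2) : Bool := decide (z 1 = 0 ∧ z 0 % 2 = 1)

/-- The level-`0` indicator of a site. [cite: DuminilCopinSmirnov2012, §3 (the levels of S_T)] -/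
def indL (z : Site 2) : ℕ := if lev0 z then 1 else 0

/-- `indL ≤ 1`. [cite: DuminilCopinSmirnov2012, §3] -/
theorem indL_le_one (z : Site 2) : indL z ≤ 1 := by unfold indL; split_ifs <;> omega

/-- The number of level-`0` vertices of the placed walk `m ↦ a + υ m`, `m ≤ n`. [cite: BeatonBousquetMelouDeGierDuminilCopinGuttmann2014, §3.2 (arXiv v5 p. 10: bc(ω), the contacts with the bottom of the strip)] -/
def levVisits (a : Site 2) (υ : ℕ → Site 2) (n : ℕ) : ℕ := ∑ m ∈ Finset.range (n + 1), indL (a + υ m)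

/-- **`Zlev_{T,n}(y)`**: the partition function of the `n`-step walks of the brick-wall strip `S_T` (translation classes) with a
fugacity `y` per vertex on the level `0`. [cite: BeatonBousquetMelouDeGierDuminilCopinGuttmann2014, §3.2 (arXiv v5 p. 10: c_{T,k}(y,z))] -/
def stripZlev (T n : ℕ) (y : ℝ) : ℝ := ∑ p ∈ stripPairs T n, y ^ levVisits p.1 p.2 n

/-- `Zlev ≥ 0` for `y ≥ 0`. [cite: BeatonBousquetMelouDeGierDuminilCopinGuttmann2014, §3.2 (arXiv v5 p. 10)] -/
theorem stripZlev_nonneg (T n : ℕ) {y : ℝ} (hy : 0 ≤ y) : 0 ≤ stripZlev T n y := sum_nonneg fun _ _ => pow_nonneg hy _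

namespace StripInsertion

variable {T n : ℕ} {ω : ℕ → Site 2} {x₀ : ℤ} {R : Finset ℤ}

/-- The insertion map on sites keeps the level-`0` test (rows are kept, columns move by multiples of `4`).
[cite: MadrasSlade1993, §8.2, Theorem 8.2.1 (8.2.13), p. 269 (statement; the insertion is the lane's proof)] -/
theorem lev0_smap (x₀ : ℤ) (R : Finset ℤ) (z : Site 2) : lev0 (smap x₀ R z) = lev0 z := by
  obtain ⟨k, hk⟩ := colMap_eq_add x₀ R (z 0)
  simp only [lev0, smap_one, smap_zero, hk]
  by_cases h : z 1 = 0 ∧ z 0 % 2 = 1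
  · rw [decide_eq_true h, decide_eq_true_iff]; omega
  · rw [decide_eq_false h, decide_eq_false_iff_not]; omega

/-- `countP lev0` of a cons. [cite: DuminilCopinSmirnov2012, §3 (the levels of S_T)] -/
theorem countP_lev0_cons (a : Site 2) (l : List (Site 2)) :
    (a :: l).countP (fun z => lev0 z) = l.countP (fun z => lev0 z) + indL a := by
  rw [List.countP_cons]; unfold indL; rfl

/-- `indL` is invariant under the insertion map on sites. [cite: MadrasSlade1993, §8.2, Theorem 8.2.1 (8.2.13), p. 269] -/
theorem indL_smap (x₀ : ℤ) (R : Finset ℤ) (z : Site 2) : indL (smap x₀ R z) = indL z := by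
  unfold indL; rw [lev0_smap]

/-- The level-`0` vertex count of `ω` on `[0, n]` as a sum of indicators. [cite: BeatonBousquetMelouDeGierDuminilCopinGuttmann2014, §3.2 (arXiv v5 p. 10)] -/
def visitsL (ω : ℕ → Site 2) (n : ℕ) : ℕ := ∑ t ∈ Finset.range (n + 1), indL (ω t)

/-- **`i₀(ω) ≤ i₀(Ψ(ω,R))` at the level of the image list**: every anchor `σ(ω t)` keeps its level-`0` status, inserted cells
only add. [cite: MadrasSlade1993, §8.2, Theorem 8.2.1 (8.2.13), p. 269 (statement; the insertion is the lane's proof)] -/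
theorem visitsL_le_countP_imageList (hW : StripWalk T ω n) :
    visitsL ω n ≤ (imageList T x₀ R ω n).countP (fun z => lev0 z) := by
  rw [imageList, List.countP_append, List.countP_flatMap, list_sum_map_range]
  simp only [Function.comp_def]
  have hblock : ∀ t ∈ Finset.range n, indL (ω t) ≤ (block T x₀ R ω n t).countP (fun z => lev0 z) := by
    intro t _
    obtain ⟨rest, hrest⟩ := block_eq_cons T x₀ R ω n t
    rw [hrest, countP_lev0_cons, indL_smap]
    exact Nat.le_add_left _ _
  have hlast : [smap x₀ R (ω n)].countP (fun z => lev0 z) = indL (ω n) := by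
    rw [countP_lev0_cons, List.countP_nil, indL_smap, zero_add]
  rw [visitsL, Finset.sum_range_succ, hlast]
  have _hW := hW
  exact Nat.add_le_add_right (Finset.sum_le_sum hblock) _

/-- Positional sum of the level-`0` indicator along a list = its count (any default value).
[cite: BeatonBousquetMelouDeGierDuminilCopinGuttmann2014, §3.2 (arXiv v5 p. 10)] -/
theorem sum_indL_getD (d : Site 2) : ∀ l : List (Site 2),
    ∑ t ∈ Finset.range l.length, indL ((l[t]?).getD d) = l.countP (fun z => lev0 z)
  | [] => by simp
  | a :: l => by
    rw [List.length_cons, Finset.sum_range_succ', countP_lev0_cons, ← sum_indL_getD d l]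
    simp only [List.getElem?_cons_succ, List.getElem?_cons_zero, Option.getD_some]

/-- Reading a list as a vertex function: the level-`0` count is the list count. [cite: BeatonBousquetMelouDeGierDuminilCopinGuttmann2014, §3.2 (arXiv v5 p. 10)] -/
theorem visitsL_ofList {l : List (Site 2)} (hl : l ≠ []) :
    visitsL (ofList l) (l.length - 1) = l.countP (fun z => lev0 z) := by
  have hlen : l.length - 1 + 1 = l.length := Nat.succ_pred_eq_of_pos (List.length_pos_of_ne_nil hl)
  unfold visitsL
  rw [hlen, ← sum_indL_getD (l.getLast?.getD 0) l]
  rfl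

end StripInsertion

section Insertion

open StripInsertion

variable {T n : ℕ}

/-- `levVisits` is the indicator sum `visitsL` of the placed walk. [cite: BeatonBousquetMelouDeGierDuminilCopinGuttmann2014, §3.2 (arXiv v5 p. 10)] -/
theorem levVisits_eq_visitsL (a : Site 2) (υ : ℕ → Site 2) (n : ℕ) :
    levVisits a υ n = visitsL (fun t => a + υ t) n := rfl

/-- **`i₀(ω) ≤ i₀(Ψ(ω,R))` for the insertion of the door «HEX-STRIP-STRICT»** (level-`0` vertices of the image pair).
[cite: MadrasSlade1993, §8.2, Theorem 8.2.1 (8.2.13), p. 269 (statement; the insertion is the lane's proof); BeatonBousquetMelouDeGierDuminilCopinGuttmann2014, Proposition 7 (arXiv v5 p. 11)] -/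
theorem levVisits_stripInsertion_ge (n : ℕ) {p : Site 2 × (ℕ → Site 2)} (R : Finset ℤ) (hp : p ∈ stripPairs T n) :
    levVisits p.1 p.2 n ≤ levVisits (stripInsertion T n p R).1 (stripInsertion T n p R).2
        (n + ∑ c ∈ R, stripInsertionCost T n p c) := by
  obtain ⟨hW, h0⟩ := stripWalk_of_mem hp
  set L := imageList T ((p.1 + p.2 0) 0) R (fun t => p.1 + p.2 t) n with hL
  have hLne : L ≠ [] := imageList_ne_nil _ _ _ _ _
  have hlen : n + ∑ c ∈ R, stripInsertionCost T n p c = L.length - 1 := by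
    rw [hL, length_imageList hW]; unfold stripInsertionCost; omega
  have himg : levVisits (stripInsertion T n p R).1 (stripInsertion T n p R).2
      (n + ∑ c ∈ R, stripInsertionCost T n p c) = L.countP (fun z => lev0 z) := by
    rw [hlen, levVisits_eq_visitsL, ← visitsL_ofList hLne]
    unfold visitsL
    refine Finset.sum_congr rfl fun t _ => ?_
    have e : (stripInsertion T n p R).1 + (stripInsertion T n p R).2 t = StripInsertion.ofList L t := by
      simp only [stripInsertion, psi, h0]; rw [hL, h0]; abel
    show indL ((stripInsertion T n p R).1 + (stripInsertion T n p R).2 t) = _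
    rw [e]
  rw [himg, levVisits_eq_visitsL]
  exact visitsL_le_countP_imageList hW

/-- **The level core of «HEX-STRIP-STRICT» for `y ≥ 1`**: for `0 < x ≤ 1`,
`Zlev_{T,n}(y) xⁿ (1 + x^{4T+8})^{⌊n/(2(T+1))⌋} ≤ Σ_{m ≤ (4T+9)n} Zlev_{T+1,m}(y) x^m` (sum over (walk, admissible cut set) of
`x^{length} y^{i₀}` of the image, bounded below walk by walk — the weight only grows since `y ≥ 1` — and above by injectivity).
[cite: BeatonBousquetMelouDeGierDuminilCopinGuttmann2014, Proposition 7 (arXiv v5 p. 11: μ_T(1,y) < μ_{T+1}(1,y); the insertion and the finite inequality are the lane's)] -/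
theorem lev_core (T n : ℕ) {x y : ℝ} (hx : 0 < x) (hx1 : x ≤ 1) (hy : 1 ≤ y) :
    stripZlev T n y * x ^ n * (1 + x ^ (4 * T + 8)) ^ (n / (2 * (T + 1))) ≤
      ∑ m ∈ Finset.range ((4 * T + 9) * n + 1), stripZlev (T + 1) m y * x ^ m := by
  classical
  obtain ⟨hcost, hmem, hinj⟩ := stripInsertion_hyp T
  have hy0 : 0 ≤ y := zero_le_one.trans hy
  set F : (Σ _ : Site 2 × (ℕ → Site 2), Finset ℤ) → ℝ := fun q =>
    x ^ insLen (stripInsertionCost T) n q *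
      y ^ levVisits (stripInsertion T n q.1 q.2).1 (stripInsertion T n q.1 q.2).2 (insLen (stripInsertionCost T) n q)
    with hF
  -- lower bound, walk by walk
  have hlow : stripZlev T n y * x ^ n * (1 + x ^ (4 * T + 8)) ^ (n / (2 * (T + 1))) ≤ ∑ q ∈ insDom T n, F q := by
    rw [insDom, Finset.sum_sigma, stripZlev, Finset.sum_mul, Finset.sum_mul]
    refine Finset.sum_le_sum fun p hp => ?_
    have hp' : (p.1, p.2) ∈ stripPairs T n := hp
    have hstep : y ^ levVisits p.1 p.2 n * x ^ n *
        ∏ c ∈ admissibleCuts T p.1 p.2 n, (1 + x ^ stripInsertionCost T n p c) ≤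
        ∑ R ∈ (admissibleCuts T p.1 p.2 n).powerset, F ⟨p, R⟩ := by
      rw [Finset.prod_one_add, Finset.mul_sum]
      refine Finset.sum_le_sum fun R _ => ?_
      have hpow : y ^ levVisits p.1 p.2 n ≤ y ^ levVisits (stripInsertion T n p R).1 (stripInsertion T n p R).2
          (n + ∑ c ∈ R, stripInsertionCost T n p c) := pow_le_pow_right₀ hy (levVisits_stripInsertion_ge n R hp)
      show y ^ levVisits p.1 p.2 n * x ^ n * ∏ c ∈ R, x ^ stripInsertionCost T n p c ≤
        x ^ (n + ∑ c ∈ R, stripInsertionCost T n p c) *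
          y ^ levVisits (stripInsertion T n p R).1 (stripInsertion T n p R).2 (n + ∑ c ∈ R, stripInsertionCost T n p c)
      rw [Finset.prod_pow_eq_pow_sum, pow_add]
      calc y ^ levVisits p.1 p.2 n * x ^ n * x ^ ∑ c ∈ R, stripInsertionCost T n p c
          = x ^ n * x ^ (∑ c ∈ R, stripInsertionCost T n p c) * y ^ levVisits p.1 p.2 n := by ring
        _ ≤ x ^ n * x ^ (∑ c ∈ R, stripInsertionCost T n p c) *
            y ^ levVisits (stripInsertion T n p R).1 (stripInsertion T n p R).2
              (n + ∑ c ∈ R, stripInsertionCost T n p c) := mul_le_mul_of_nonneg_left hpow (by positivity)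
    refine le_trans ?_ hstep
    refine mul_le_mul_of_nonneg_left ?_ (by positivity)
    calc (1 + x ^ (4 * T + 8)) ^ (n / (2 * (T + 1)))
        ≤ (1 + x ^ (4 * T + 8)) ^ (admissibleCuts T p.1 p.2 n).card :=
          pow_le_pow_right₀ (by nlinarith [pow_nonneg hx.le (4 * T + 8)]) (div_le_card_admissibleCuts hp')
      _ = ∏ _c ∈ admissibleCuts T p.1 p.2 n, (1 + x ^ (4 * T + 8)) := (Finset.prod_const _).symm
      _ ≤ ∏ c ∈ admissibleCuts T p.1 p.2 n, (1 + x ^ stripInsertionCost T n p c) :=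
          Finset.prod_le_prod (fun c _ => by nlinarith [pow_nonneg hx.le (4 * T + 8)]) fun c hc => by
            have := pow_le_pow_of_le_one hx.le hx1 (hcost n p hp c hc)
            linarith
  -- upper bound, by injectivity, fiberwise in the image length
  have hup : ∑ q ∈ insDom T n, F q ≤ ∑ m ∈ Finset.range ((4 * T + 9) * n + 1), stripZlev (T + 1) m y * x ^ m := by
    rw [← Finset.sum_fiberwise_of_maps_to (g := insLen (stripInsertionCost T) n)
      (t := Finset.range ((4 * T + 9) * n + 1)) fun q hq => Finset.mem_range.2 (Nat.lt_succ_of_le (insLen_le (hcost n) hq))]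
    refine Finset.sum_le_sum fun m _ => ?_
    have e1 : ∑ q ∈ (insDom T n).filter (fun q => insLen (stripInsertionCost T) n q = m), F q =
        x ^ m * ∑ q ∈ (insDom T n).filter (fun q => insLen (stripInsertionCost T) n q = m),
          y ^ levVisits (stripInsertion T n q.1 q.2).1 (stripInsertion T n q.1 q.2).2 m := by
      rw [Finset.mul_sum]
      refine Finset.sum_congr rfl fun q hq => ?_
      rw [hF]; simp only
      rw [(Finset.mem_filter.1 hq).2]
    rw [e1, mul_comm]
    refine mul_le_mul_of_nonneg_right ?_ (pow_nonneg hx.le m)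
    rw [stripZlev, ← Finset.sum_image (f := fun p' : Site 2 × (ℕ → Site 2) => y ^ levVisits p'.1 p'.2 m)
      (g := fun q : (Σ _ : Site 2 × (ℕ → Site 2), Finset ℤ) => stripInsertion T n q.1 q.2)
      (hinj n |>.mono fun q hq => by
        have h := Finset.mem_filter.1 (Finset.mem_coe.1 hq)
        obtain ⟨h1, h2⟩ := mem_insDom.1 h.1
        exact ⟨h1, h2⟩)]
    refine Finset.sum_le_sum_of_subset_of_nonneg (fun p' hp' => ?_) fun _ _ _ => pow_nonneg hy0 _
    obtain ⟨q, hq, rfl⟩ := Finset.mem_image.1 hp'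
    obtain ⟨hq1, hqm⟩ := Finset.mem_filter.1 hq
    obtain ⟨hqp, hqR⟩ := mem_insDom.1 hq1
    have := hmem n q.1 q.2 hqp hqR
    rw [show n + ∑ c ∈ q.2, stripInsertionCost T n q.1 c = m from hqm] at this
    exact this
  exact hlow.trans hup

end Insertion

end HexBW

/-! ## Honeycomb side: the bottom-level weight, the reflection of `S_T`, and the dictionary -/

namespace HV

/-- The number of vertices of `l` on the bottom level `0` of `S_T`. [cite: BeatonBousquetMelouDeGierDuminilCopinGuttmann2014, §3.2 (arXiv v5 p. 10: bc(ω), the contacts with the bottom of the strip)] -/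
def botCnt (l : List HV) : ℕ := (l.filter fun v => lev v = 0).length

/-- The bottom-weighted partition function `Z^{bot}_{T,n}(y) = Σ_{stripChains T n} y^{botCnt}`. [cite: BeatonBousquetMelouDeGierDuminilCopinGuttmann2014, §3.2 (arXiv v5 p. 10: c_{T,k}(y,1))] -/
def stripZB (T n : ℕ) (y : ℝ) : ℝ := ∑ l ∈ stripChains T n, y ^ botCnt l

/-- `Z^{bot} ≥ 0` for `y ≥ 0`. [cite: BeatonBousquetMelouDeGierDuminilCopinGuttmann2014, §3.2 (arXiv v5 p. 10)] -/
theorem stripZB_nonneg (T n : ℕ) {y : ℝ} (hy : 0 ≤ y) : 0 ≤ stripZB T n y := sum_nonneg fun _ _ => pow_nonneg hy _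

/-! ### The top–bottom reflection of the strip -/

/-- The reflection of `S_T` exchanging its top and bottom levels: `v ↦ shift 0 T (flip v)`, `lev ↦ 2T − 1 − lev`, `x₀ ↦ −x₀`.
[cite: BeatonBousquetMelouDeGierDuminilCopinGuttmann2014, Proposition 6 (arXiv v5 p. 10: "By the symmetry of bridges, μ_T(y,z) = μ_T(z,y)")] -/
def tbFlip (T : ℕ) : hvGraph ≃g hvGraph := flip.trans (shift 0 T)

/-- `tbFlip` in coordinates. [cite: BeatonBousquetMelouDeGierDuminilCopinGuttmann2014, Proposition 6 (arXiv v5 p. 10)] -/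
@[simp] theorem tbFlip_apply (T : ℕ) (v : HV) : tbFlip T v = (-v.1, -v.2.1 - 1 + T, !v.2.2) := by
  obtain ⟨a, b, c⟩ := v
  simp [tbFlip]

/-- `tbFlip` reverses the levels of `S_T`. [cite: BeatonBousquetMelouDeGierDuminilCopinGuttmann2014, Proposition 6 (arXiv v5 p. 10)] -/
theorem lev_tbFlip (T : ℕ) (v : HV) : lev (tbFlip T v) = 2 * (T : ℤ) - 1 - lev v := by
  obtain ⟨a, b, c⟩ := v
  cases c <;> simp [lev, bit] <;> ring

/-- `tbFlip` is an involution. [cite: BeatonBousquetMelouDeGierDuminilCopinGuttmann2014, Proposition 6 (arXiv v5 p. 10)] -/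
theorem tbFlip_tbFlip (T : ℕ) (v : HV) : tbFlip T (tbFlip T v) = v := by
  obtain ⟨a, b, c⟩ := v
  simp only [tbFlip_apply, neg_neg, Bool.not_not, Prod.mk.injEq, true_and, and_true]
  ring

/-- The reflection of a strip chain is a strip chain. [cite: BeatonBousquetMelouDeGierDuminilCopinGuttmann2014, Proposition 6 (arXiv v5 p. 10)] -/
theorem map_tbFlip_mem {T n : ℕ} {l : List HV} (hl : l ∈ stripChains T n) : l.map (tbFlip T) ∈ stripChains T n := by
  obtain ⟨hc, hnd, hlen, ⟨v, hh, hv⟩, hin⟩ := mem_stripChains_iff.1 hl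
  refine mem_stripChains_iff.2 ⟨?_, hnd.map (tbFlip T).injective, by rw [List.length_map, hlen], ?_, fun w hw => ?_⟩
  · rw [List.isChain_map]; exact hc.imp fun a b h => (tbFlip T).map_rel_iff.2 h
  · refine ⟨tbFlip T v, by rw [List.head?_map, hh]; rfl, ?_⟩
    rw [tbFlip_apply]; simp [hv]
  · rw [List.mem_map] at hw
    obtain ⟨u, hu, rfl⟩ := hw
    have := hin u hu
    rw [lev_tbFlip]; omega

/-- The reflection turns the bottom count into the top count. [cite: BeatonBousquetMelouDeGierDuminilCopinGuttmann2014, Proposition 6 (arXiv v5 p. 10)] -/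
theorem topCnt_map_tbFlip (T : ℕ) (l : List HV) : topCnt T (l.map (tbFlip T)) = botCnt l := by
  unfold topCnt botCnt
  rw [List.filter_map, List.length_map]
  congr 1
  refine List.filter_congr fun w _ => ?_
  simp only [Function.comp_apply, lev_tbFlip, decide_eq_decide]; omega

/-- **Symmetry of the strip: `Z^{top}_{T,n}(y) = Z^{bot}_{T,n}(y)`.**
[cite: BeatonBousquetMelouDeGierDuminilCopinGuttmann2014, Proposition 6 (arXiv v5 p. 10: "μ_T(y,z) = μ_T(z,y), and so, in particular, μ_T(y,1) = μ_T(1,y)")] -/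
theorem stripZL_eq_stripZB (T n : ℕ) (y : ℝ) : stripZL T n y = stripZB T n y := by
  classical
  have himage : (stripChains T n).image (fun l => l.map (tbFlip T)) = stripChains T n := by
    ext l
    constructor
    · intro h
      obtain ⟨l', hl', rfl⟩ := mem_image.1 h
      exact map_tbFlip_mem hl'
    · intro h
      refine mem_image.2 ⟨l.map (tbFlip T), map_tbFlip_mem h, ?_⟩
      rw [List.map_map]
      conv_rhs => rw [← List.map_id l]
      exact List.map_congr_left fun v _ => tbFlip_tbFlip T v
  have hinj : Set.InjOn (fun l : List HV => l.map (tbFlip T)) (stripChains T n) :=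
    fun l _ l' _ h => (List.map_injective_iff.2 (tbFlip T).injective) h
  rw [stripZL, ← himage, sum_image hinj, stripZB]
  exact sum_congr rfl fun l _ => by rw [topCnt_map_tbFlip]

/-! ### The dictionary with the brick-wall level-`0` partition functions -/

/-- Positional sum of a Boolean indicator along a list = length of the filter (any default value). [cite: MadrasSlade1993, §8.2, eq. (8.2.1)] -/
theorem sum_range_toNat_getD (P : HV → Bool) (d : HV) : ∀ l : List HV,
    ∑ t ∈ Finset.range l.length, (P ((l[t]?).getD d)).toNat = (l.filter P).length
  | [] => by simp
  | a :: l => by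
    rw [List.length_cons, Finset.sum_range_succ', List.filter_cons]
    simp only [List.getElem?_cons_succ, List.getElem?_cons_zero, Option.getD_some]
    rw [sum_range_toNat_getD P d l]
    cases P a <;> simp

/-- Under the transfer `toPair`, the level-`0` visits of the brick-wall pair are the bottom-level vertices of the honeycomb list.
[cite: EntingJensen2009, §7.4.2 (brickwork form of the honeycomb lattice); DuminilCopinSmirnov2012, §3 (levels)] -/
theorem levVisits_toPair {l : List HV} {n : ℕ} (hlen : l.length = n + 1) :
    HexBW.levVisits (toPair l).1 (toPair l).2 n = botCnt l := by
  set p₀ := (toBWList l).headD 0 with hp₀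
  have key : ∀ t ∈ Finset.range (n + 1),
      HexBW.indL ((toPair l).1 + (toPair l).2 t) = (decide (lev ((l[t]?).getD hvOrigin) = 0)).toNat := by
    intro t ht
    rw [Finset.mem_range] at ht
    have htl : t < l.length := by omega
    have e1 : (toPair l).1 + (toPair l).2 t = (HexBW.snorm p₀ - p₀) + HexBW.hvToRow l[t] := by
      simp only [toPair, ← hp₀]
      rw [HexBW.StripInsertion.ofList, toBWList, List.getElem?_map, List.getElem?_eq_getElem htl, Option.map_some,
        Option.getD_some, HexBW.rowIso_symm_apply]
      abel
    have e2 : (l[t]?).getD hvOrigin = l[t] := by rw [List.getElem?_eq_getElem htl, Option.getD_some]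
    rw [e1, e2, HexBW.indL]
    have hev := HexBW.snorm_shift_even p₀
    obtain ⟨a, b, c⟩ := l[t]
    have hiff : (HexBW.lev0 ((HexBW.snorm p₀ - p₀) + HexBW.hvToRow (a, b, c)) = true) ↔ lev (a, b, c) = 0 := by
      simp only [HexBW.lev0, decide_eq_true_eq, Pi.add_apply, Pi.sub_apply, HexBW.snorm_apply_one, HexBW.snorm_apply_zero,
        HexBW.hvToRow_apply_one, HexBW.hvToRow_apply_zero, lev_mk]
      simp only [Pi.sub_apply, HexBW.snorm_apply_zero, HexBW.snorm_apply_one] at hev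
      cases c <;> simp [bit] <;> omega
    by_cases h : lev (a, b, c) = 0
    · rw [if_pos (hiff.2 h), decide_eq_true h]; rfl
    · rw [if_neg (fun h' => h (hiff.1 h')), decide_eq_false h]; rfl
  unfold HexBW.levVisits
  rw [Finset.sum_congr rfl key, ← hlen, sum_range_toNat_getD (fun v => decide (lev v = 0)) hvOrigin l, botCnt]

/-- Self-avoiding lists from different heads are different. [cite: MadrasSlade1993, §8.2, eq. (8.2.1)] -/
theorem disjoint_sawFin_filter {v w : HV} (h : v ≠ w) (n : ℕ) (P : List HV → Prop) [DecidablePred P] :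
    Disjoint ((sawFin v n).filter P) ((sawFin w n).filter P) := by
  rw [Finset.disjoint_left]
  intro l hl hl'
  rw [mem_filter, mem_sawFin_iff, mem_sawLists_iff] at hl hl'
  exact h (Option.some_inj.1 (hl.1.2.1.symm.trans hl'.1.2.1))

/-- **Dictionary, first direction: `Z^{bot}_{T,n}(y) ≤ 2T · Zlev_{T−1,n}(y)`** (`T ≥ 1`, `y ≥ 0`): per standard head, `toPair`
injects the honeycomb strip chains into the brick-wall strip pairs, preserving the level-`0` weight.
[cite: MadrasSlade1993, §8.2, eq. (8.2.1); EntingJensen2009, §7.4.2] -/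
theorem stripZB_le {T : ℕ} (hT : 1 ≤ T) (n : ℕ) {y : ℝ} (hy : 0 ≤ y) :
    stripZB T n y ≤ 2 * T * HexBW.stripZlev (T - 1) n y := by
  classical
  have hZ0 := HexBW.stripZlev_nonneg (T - 1) n hy
  rw [stripZB, stripChains, filter_biUnion, sum_biUnion fun v _ w _ hvw => disjoint_sawFin_filter hvw n (InLev T)]
  have hhead : ∀ v ∈ stdHeads T, ∑ l ∈ (sawFin v n).filter (InLev T), y ^ botCnt l ≤ HexBW.stripZlev (T - 1) n y := by
    intro v _
    rw [HexBW.stripZlev]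
    have hw : ∀ l ∈ (sawFin v n).filter (InLev T), y ^ botCnt l = y ^ HexBW.levVisits (toPair l).1 (toPair l).2 n := by
      intro l hl
      rw [mem_filter, mem_sawFin_iff, mem_sawLists_iff] at hl
      rw [levVisits_toPair hl.1.2.2.1]
    rw [sum_congr rfl hw]
    refine sum_le_sum_of_injOn_of_nonneg toPair (fun l hl l' hl' h => ?_) (fun l hl => ?_)
      (fun p => y ^ HexBW.levVisits p.1 p.2 n) fun _ _ => pow_nonneg hy _
    · rw [mem_coe, mem_filter, mem_sawFin_iff, mem_sawLists_iff] at hl hl'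
      exact toPair_inj (by rintro rfl; simp at hl) (by rintro rfl; simp at hl') (hl.1.2.1.trans hl'.1.2.1.symm)
        (hl.1.2.2.1.trans hl'.1.2.2.1.symm) h
    · rw [mem_filter, mem_sawFin_iff, mem_sawLists_iff] at hl
      obtain ⟨⟨hc, hh, hlen, hnd⟩, hin⟩ := hl
      have := toPair_mem hT (by rintro rfl; simp at hlen) hc hnd hin
      rwa [hlen, Nat.add_sub_cancel] at this
  calc ∑ v ∈ stdHeads T, ∑ l ∈ (sawFin v n).filter (InLev T), y ^ botCnt l
      ≤ ∑ _v ∈ stdHeads T, HexBW.stripZlev (T - 1) n y := sum_le_sum hhead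
    _ = (stdHeads T).card * HexBW.stripZlev (T - 1) n y := by rw [sum_const, nsmul_eq_mul]
    _ ≤ 2 * T * HexBW.stripZlev (T - 1) n y := by
        refine mul_le_mul_of_nonneg_right ?_ hZ0
        have := card_image_le (s := Finset.range T ×ˢ (univ : Finset Bool)) (f := fun jb : ℕ × Bool => ((0 : ℤ), (jb.1 : ℤ), jb.2))
        rw [card_product, card_range, card_univ, Fintype.card_bool] at this
        exact_mod_cast (show (stdHeads T).card ≤ 2 * T by rw [stdHeads]; omega)

/-- The honeycomb reading of a brick-wall strip pair: the placed walk through `rowIso` (head = `rowIso` of the start).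
[cite: EntingJensen2009, §7.4.2 (brickwork form of the honeycomb lattice); MadrasSlade1993, §8.2, eq. (8.2.1)] -/
def bwRead (m : ℕ) (p : Site 2 × (ℕ → Site 2)) : List HV := (List.range (m + 1)).map fun i => HexBW.rowIso (p.1 + p.2 i)

/-- The standardised honeycomb reading. [cite: MadrasSlade1993, §8.2, eq. (8.2.1)] -/
def bwToHV (m : ℕ) (p : Site 2 × (ℕ → Site 2)) : List HV := xstd (bwRead m p)

/-- Entries of the reading. [cite: EntingJensen2009, §7.4.2] -/
theorem getElem?_bwRead {m : ℕ} (p : Site 2 × (ℕ → Site 2)) {i : ℕ} (hi : i < m + 1) :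
    (bwRead m p)[i]? = some (HexBW.rowIso (p.1 + p.2 i)) := by
  rw [bwRead, List.getElem?_map, List.getElem?_range hi, Option.map_some]

/-- The level of the honeycomb vertex over a brick-wall site is `0` iff the site passes the `lev0` test (for sites of non-negative row).
[cite: DuminilCopinSmirnov2012, §3 (levels); EntingJensen2009, §7.4.2] -/
theorem lev_rowIso_eq_zero_iff {z : Site 2} (hz : 0 ≤ z 1) : lev (HexBW.rowIso z) = 0 ↔ HexBW.lev0 z = true := by
  rw [HexBW.lev_rowIso, HexBW.lev0, decide_eq_true_eq]; omega

/-- A horizontal translation keeps `botCnt`. [cite: MadrasSlade1993, §8.2, eq. (8.2.1)] -/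
theorem botCnt_map_shift (a : ℤ) (l : List HV) : botCnt (l.map (shift a 0)) = botCnt l := by
  unfold botCnt
  rw [List.filter_map, List.length_map]
  congr 1
  refine List.filter_congr fun v _ => ?_
  simp only [Function.comp_apply, lev_shift_zero]

/-- The reading of a strip pair of `S_T` (brick wall) is, once standardised, a strip chain of `S_{T+1}` (Duminil-Copin–Smirnov)
with `botCnt = levVisits`. [cite: MadrasSlade1993, §8.2, eq. (8.2.1); EntingJensen2009, §7.4.2] -/
theorem bwToHV_mem {T m : ℕ} {p : Site 2 × (ℕ → Site 2)} (hp : p ∈ HexBW.stripPairs T m) :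
    bwToHV m p ∈ stripChains (T + 1) m ∧ botCnt (bwToHV m p) = HexBW.levVisits p.1 p.2 m := by
  obtain ⟨-, hυ, hbw, hin⟩ := HexBW.mem_stripPairs.1 hp
  obtain ⟨-, -, -, hinj⟩ := Zd.mem_saws.1 hυ
  have hLlen : (bwRead m p).length = m + 1 := by simp [bwRead]
  constructor
  · refine mem_stripChains_iff.2 ⟨isChain_xstd ?_, nodup_xstd ?_, by rw [bwToHV, length_xstd, hLlen], ?_, inLev_xstd ?_⟩
    · rw [bwRead, List.isChain_map, List.isChain_range_succ]
      exact fun i hi => HexBW.rowIso.map_rel_iff.2 (hbw i hi)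
    · rw [bwRead]
      refine (List.nodup_range).map_on fun i hi j hj h => ?_
      rw [List.mem_range] at hi hj
      exact hinj (show i ≤ m by omega) (show j ≤ m by omega) (add_left_cancel (HexBW.rowIso.injective h))
    · refine ⟨(0, (HexBW.rowIso (p.1 + p.2 0)).2.1, (HexBW.rowIso (p.1 + p.2 0)).2.2), head?_xstd ?_, rfl⟩
      rw [List.head?_eq_getElem?, getElem?_bwRead p (by omega)]
    · intro w hw
      rw [bwRead, List.mem_map] at hw
      obtain ⟨i, hi, rfl⟩ := hw
      rw [List.mem_range] at hi
      have h := (HexBW.inStrip_iff_lev_rowIso T _).1 (hin i (by omega))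
      exact ⟨h.1, by push_cast; omega⟩
  · rw [bwToHV, xstd, botCnt_map_shift, HexBW.levVisits, botCnt,
      ← sum_range_toNat_getD (fun v => decide (lev v = 0)) hvOrigin (bwRead m p), hLlen]
    refine sum_congr rfl fun t ht => ?_
    rw [Finset.mem_range] at ht
    rw [getElem?_bwRead p ht, Option.getD_some, HexBW.indL]
    have hz : 0 ≤ (p.1 + p.2 t) 1 := (hin t (by omega)).1
    by_cases h : HexBW.lev0 (p.1 + p.2 t) = true
    · rw [if_pos h, decide_eq_true ((lev_rowIso_eq_zero_iff hz).2 h)]; rfl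
    · rw [if_neg h, decide_eq_false (fun h' => h ((lev_rowIso_eq_zero_iff hz).1 h'))]; rfl

/-- For a fixed starting site the standardised reading is injective on `stripPairs T m`. [cite: MadrasSlade1993, §8.2, eq. (8.2.1)] -/
theorem bwToHV_inj {T m : ℕ} {p p' : Site 2 × (ℕ → Site 2)} (hp : p ∈ HexBW.stripPairs T m) (hp' : p' ∈ HexBW.stripPairs T m)
    (ha : p.1 = p'.1) (h : bwToHV m p = bwToHV m p') : p = p' := by
  obtain ⟨-, hυ, -, -⟩ := HexBW.mem_stripPairs.1 hp
  obtain ⟨-, hυ', -, -⟩ := HexBW.mem_stripPairs.1 hp'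
  obtain ⟨h0, hev, -, -⟩ := Zd.mem_saws.1 hυ
  obtain ⟨h0', hev', -, -⟩ := Zd.mem_saws.1 hυ'
  have hhead : (bwRead m p).head? = (bwRead m p').head? := by
    rw [List.head?_eq_getElem?, List.head?_eq_getElem?, getElem?_bwRead p (by omega), getElem?_bwRead p' (by omega), h0, h0', ha]
  have hL := xstd_inj_of_head h hhead
  have hpt : ∀ i ≤ m, p.2 i = p'.2 i := by
    intro i hi
    have e := congrArg (fun L : List HV => L[i]?) hL
    simp only [getElem?_bwRead p (show i < m + 1 by omega), getElem?_bwRead p' (show i < m + 1 by omega), Option.some_inj] at e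
    have e' := HexBW.rowIso.injective e
    rw [ha] at e'
    exact add_left_cancel e'
  refine Prod.ext ha (funext fun i => ?_)
  rcases le_or_gt i m with hi | hi
  · exact hpt i hi
  · rw [hev i hi.le, hev' i hi.le, hpt m le_rfl]

/-- **Dictionary, second direction: `Zlev_{T,m}(y) ≤ 2(T+1) · Z^{bot}_{T+1,m}(y)`** (`y ≥ 0`): for a fixed starting site the
honeycomb reading is injective and weight-preserving. [cite: MadrasSlade1993, §8.2, eq. (8.2.1); EntingJensen2009, §7.4.2] -/
theorem stripZlev_le (T m : ℕ) {y : ℝ} (hy : 0 ≤ y) :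
    HexBW.stripZlev T m y ≤ 2 * (T + 1) * stripZB (T + 1) m y := by
  classical
  rw [HexBW.stripZlev, ← sum_fiberwise_of_maps_to (s := HexBW.stripPairs T m) (t := HexBW.stripStarts T) (g := Prod.fst)
    fun p hp => (HexBW.mem_stripPairs.1 hp).1]
  have hfib : ∀ a ∈ HexBW.stripStarts T, ∑ p ∈ (HexBW.stripPairs T m).filter (fun p => p.1 = a), y ^ HexBW.levVisits p.1 p.2 m ≤
      stripZB (T + 1) m y := by
    intro a _
    have hw : ∀ p ∈ (HexBW.stripPairs T m).filter (fun p => p.1 = a), y ^ HexBW.levVisits p.1 p.2 m = y ^ botCnt (bwToHV m p) := by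
      intro p hp; rw [(bwToHV_mem (mem_filter.1 hp).1).2]
    rw [sum_congr rfl hw, stripZB]
    refine sum_le_sum_of_injOn_of_nonneg (bwToHV m) (fun p hp p' hp' h => ?_) (fun p hp => (bwToHV_mem (mem_filter.1 hp).1).1)
      (fun l => y ^ botCnt l) fun _ _ => pow_nonneg hy _
    rw [mem_coe, mem_filter] at hp hp'
    exact bwToHV_inj hp.1 hp'.1 (hp.2.trans hp'.2.symm) h
  calc ∑ a ∈ HexBW.stripStarts T, ∑ p ∈ (HexBW.stripPairs T m).filter (fun p => p.1 = a), y ^ HexBW.levVisits p.1 p.2 m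
      ≤ ∑ _a ∈ HexBW.stripStarts T, stripZB (T + 1) m y := sum_le_sum hfib
    _ = 2 * (T + 1) * stripZB (T + 1) m y := by
        rw [sum_const, nsmul_eq_mul, HexBW.card_stripStarts]; push_cast; ring

/-! ### Proposition 7 for the top-level weight, `y ≥ 1` -/

/-- `1 ≤ ν_T(y)` for `y ≥ 1`, `T ≥ 1`. [cite: BeatonBousquetMelouDeGierDuminilCopinGuttmann2014, Proposition 6 (arXiv v5 p. 10)] -/
theorem one_le_stripNu {T : ℕ} (hT : 1 ≤ T) {y : ℝ} (hy : 1 ≤ y) : 1 ≤ stripNu T y := by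
  refine le_ciInf fun n => ?_
  have hmin : min 1 y = 1 := min_eq_left hy
  have h1 : (1 : ℝ) ≤ HexBW.yK y * stripZL T (n + 1) y := by
    have := min_pow_le_stripZL hT (n + 1) (zero_lt_one.trans_le hy)
    rw [hmin, one_pow] at this
    exact this.trans (le_mul_of_one_le_left (stripZL_nonneg T _ (zero_le_one.trans hy)) (HexBW.one_le_yK y))
  exact Real.one_le_rpow h1 (by positivity)

/-- **The honeycomb top-level core** (`T ≥ 1`, `y ≥ 1`, `0 < x ≤ 1`):
`Z_{T,n}(y) xⁿ (1 + x^{4T+4})^{⌊n/(2T)⌋} ≤ 4T(T+1) Σ_{m ≤ (4T+5)n} Z_{T+1,m}(y) x^m` — the brick-wall level core transported by the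
reflection and the dictionary. [cite: BeatonBousquetMelouDeGierDuminilCopinGuttmann2014, Proposition 7 (arXiv v5 p. 11)] -/
theorem top_core {T : ℕ} (hT : 1 ≤ T) (n : ℕ) {x y : ℝ} (hx : 0 < x) (hx1 : x ≤ 1) (hy : 1 ≤ y) :
    stripZL T n y * x ^ n * (1 + x ^ (4 * (T - 1) + 8)) ^ (n / (2 * (T - 1 + 1))) ≤
      (2 * T) * (2 * (T + 1)) * ∑ m ∈ Finset.range ((4 * (T - 1) + 9) * n + 1), stripZL (T + 1) m y * x ^ m := by
  have hy0 : 0 ≤ y := zero_le_one.trans hy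
  have h1 : stripZL T n y ≤ 2 * T * HexBW.stripZlev (T - 1) n y := by rw [stripZL_eq_stripZB]; exact stripZB_le hT n hy0
  have h2 := HexBW.lev_core (T - 1) n hx hx1 hy
  rw [Nat.sub_add_cancel hT] at h2
  have h3 : ∀ m, HexBW.stripZlev T m y ≤ 2 * (T + 1) * stripZL (T + 1) m y := by
    intro m
    have := stripZlev_le T m hy0
    rwa [← stripZL_eq_stripZB] at this
  have hfac : 0 ≤ x ^ n * (1 + x ^ (4 * (T - 1) + 8)) ^ (n / (2 * T)) := by positivity
  have hsum : ∑ m ∈ Finset.range ((4 * (T - 1) + 9) * n + 1), 2 * ((T : ℝ) + 1) * stripZL (T + 1) m y * x ^ m =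
      2 * ((T : ℝ) + 1) * ∑ m ∈ Finset.range ((4 * (T - 1) + 9) * n + 1), stripZL (T + 1) m y * x ^ m := by
    rw [mul_sum]; exact sum_congr rfl fun m _ => by ring
  rw [Nat.sub_add_cancel hT]
  calc stripZL T n y * x ^ n * (1 + x ^ (4 * (T - 1) + 8)) ^ (n / (2 * T))
      = stripZL T n y * (x ^ n * (1 + x ^ (4 * (T - 1) + 8)) ^ (n / (2 * T))) := by ring
    _ ≤ (2 * T * HexBW.stripZlev (T - 1) n y) * (x ^ n * (1 + x ^ (4 * (T - 1) + 8)) ^ (n / (2 * T))) :=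
        mul_le_mul_of_nonneg_right h1 hfac
    _ = 2 * T * (HexBW.stripZlev (T - 1) n y * x ^ n * (1 + x ^ (4 * (T - 1) + 8)) ^ (n / (2 * T))) := by ring
    _ ≤ 2 * T * ∑ m ∈ Finset.range ((4 * (T - 1) + 9) * n + 1), HexBW.stripZlev T m y * x ^ m :=
        mul_le_mul_of_nonneg_left h2 (by positivity)
    _ ≤ 2 * T * ∑ m ∈ Finset.range ((4 * (T - 1) + 9) * n + 1), 2 * ((T : ℝ) + 1) * stripZL (T + 1) m y * x ^ m := by
        refine mul_le_mul_of_nonneg_left (sum_le_sum fun m _ => ?_) (by positivity)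
        exact mul_le_mul_of_nonneg_right (h3 m) (pow_nonneg hx.le m)
    _ = (2 * T) * (2 * (T + 1)) * ∑ m ∈ Finset.range ((4 * (T - 1) + 9) * n + 1), stripZL (T + 1) m y * x ^ m := by
        rw [hsum]; ring

open MarginExtraction in
/-- **Proposition 7 (strict part) for the TOP-LEVEL weight, `y ≥ 1`, WITH MARGIN**:
`log(1 + ν_{T+1}(y)^{-(4T+4)}) / (2T) ≤ log ν_{T+1}(y) − log ν_T(y)` (`T ≥ 1`).
[cite: BeatonBousquetMelouDeGierDuminilCopinGuttmann2014, Proposition 7 (arXiv v5 p. 11: μ_T(1,y) < μ_{T+1}(1,y); printed without a rate — the margin and the insertion proof are the lane's)] -/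
theorem log_stripNu_succ_sub_log_ge {T : ℕ} (hT : 1 ≤ T) {y : ℝ} (hy : 1 ≤ y) :
    Real.log (1 + stripNu (T + 1) y ^ (-(4 * (T : ℝ) + 4))) / (2 * (T : ℝ)) ≤
      Real.log (stripNu (T + 1) y) - Real.log (stripNu T y) := by
  have hy0 : 0 < y := zero_lt_one.trans_le hy
  have hK := HexBW.one_le_yK y
  have hK0 : 0 < HexBW.yK y := by linarith
  have hνpos := stripNu_pos hT hy0
  have hT1 : 1 ≤ T + 1 := by omega
  have hB : 0 ≤ HexBW.yK y * ((2 * T) * (2 * (T + 1)) : ℝ) := by positivity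
  have hx := log_margin_of_core (E := 4 * (T - 1) + 8) (L := 2 * (T - 1) + 1) (K := 4 * (T - 1) + 9)
    (C := fun m => stripZL (T + 1) m y) (B := HexBW.yK y * ((2 * T) * (2 * (T + 1)))) hνpos
    (one_le_stripNu hT1 hy) hB (fun m => stripZL_nonneg (T + 1) m hy0.le) (tendsto_stripZL_rpow hT1 hy0)
    fun n x hx0 hx1 => by
      have e : n / (2 * (T - 1) + 1 + 1) = n / (2 * (T - 1 + 1)) := by congr 1
      rw [e]
      have hpow := pow_stripNu_le hT n hy0 hνpos.le
      have hcore := top_core hT n hx0 hx1 hy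
      have hb : 0 ≤ (1 + x ^ (4 * (T - 1) + 8)) ^ (n / (2 * (T - 1 + 1))) := by positivity
      calc stripNu T y ^ n * x ^ n * (1 + x ^ (4 * (T - 1) + 8)) ^ (n / (2 * (T - 1 + 1)))
          ≤ (HexBW.yK y * stripZL T n y) * x ^ n * (1 + x ^ (4 * (T - 1) + 8)) ^ (n / (2 * (T - 1 + 1))) :=
            mul_le_mul_of_nonneg_right (mul_le_mul_of_nonneg_right hpow (pow_nonneg hx0.le n)) hb
        _ = HexBW.yK y * (stripZL T n y * x ^ n * (1 + x ^ (4 * (T - 1) + 8)) ^ (n / (2 * (T - 1 + 1)))) := by ring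
        _ ≤ HexBW.yK y * ((2 * T) * (2 * (T + 1)) *
              ∑ m ∈ Finset.range ((4 * (T - 1) + 9) * n + 1), stripZL (T + 1) m y * x ^ m) :=
            mul_le_mul_of_nonneg_left hcore hK0.le
        _ = HexBW.yK y * ((2 * T) * (2 * (T + 1))) *
              ∑ m ∈ Finset.range ((4 * (T - 1) + 9) * n + 1), stripZL (T + 1) m y * x ^ m := by ring
  have e1 : ((4 * (T - 1) + 8 : ℕ) : ℝ) = 4 * (T : ℝ) + 4 := by push_cast [Nat.cast_sub hT]; ring
  have e2 : ((2 * (T - 1) + 1 : ℕ) : ℝ) + 1 = 2 * (T : ℝ) := by push_cast [Nat.cast_sub hT]; ring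
  rwa [e1, e2] at hx

/-- **Proposition 7 of BBdGDCG 2014, strict part, for the TOP-LEVEL weight and every `y ≥ 1`**: `ν_T(y) < ν_{T+1}(y)` (`T ≥ 1`).
[cite: BeatonBousquetMelouDeGierDuminilCopinGuttmann2014, Proposition 7 (arXiv v5 p. 11: "For y > 0, we have μ_T(1,y) < μ_{T+1}(1,y)"); there via unfolded-arch factorisation, not the proof formalised] -/
theorem stripNu_lt_succ {T : ℕ} (hT : 1 ≤ T) {y : ℝ} (hy : 1 ≤ y) : stripNu T y < stripNu (T + 1) y := by
  have hy0 : 0 < y := zero_lt_one.trans_le hy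
  have hm := log_stripNu_succ_sub_log_ge hT hy
  have hμ := stripNu_pos (T := T + 1) (by omega) hy0
  have hT0 : (0 : ℝ) < 2 * (T : ℝ) := by have : (1 : ℝ) ≤ T := by exact_mod_cast hT
                                         linarith
  have hpos : 0 < Real.log (1 + stripNu (T + 1) y ^ (-(4 * (T : ℝ) + 4))) / (2 * (T : ℝ)) :=
    div_pos (Real.log_pos (by nlinarith [Real.rpow_pos_of_pos hμ (-(4 * (T : ℝ) + 4))])) hT0
  have : Real.log (stripNu T y) < Real.log (stripNu (T + 1) y) := by linarith
  exact (Real.log_lt_log_iff (stripNu_pos hT hy0) hμ).1 this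

end HV

end Literature.Probability.RandomPlanarGeometry.SAW
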